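import Mathlib
import Summits.CriticalPhenomena.PercolationContinuityZ3.Theorems.PercNearOneGluingNoHeavyLowerTailDiffHurwitzChain
import HarnessLib

/-!
# The difference–Hurwitz matrix and its Routh steps

Support file for the Sahi / Conjecture-P programme of route `PercNearOneGluingNoHeavy`
(`--supports stmt-CriticalPhenomena-4575`, prover prim-l12-p5 gen 48; proof note
`prim-l12-p5/PROOF-DIFFERENCE-HURWITZ-g48.md` §2).  No definitions, no named facts, no sorries.

For `β > 0` let `Θ = βD + N̂` (`D = M[∂]`, `N̂ = diag(n)`) and `Φ = βI + S`.  For a function `f` the matrix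
`f(Θ)` (a polynomial in `Θ` when `f` is a polynomial, written in the falling-factorial basis) has the rows
`A_f(n,l) = C(n,l) β^{n-l} (Δ^{n-l} f)(l)` (`l ≤ n`, `Δ` the unit forward difference) and `f(Θ)Φ` has the
rows `B_f(n,l) = β A_f(n,l) + A_f(n,l-1)`.  The two steps of the DISCRETE ROUTH ALGORITHM rest on
* `A_{x ↦ x·q(x-1)}(n+1,·) = (n+1) · B_q(n,·)`  (`D·q(Θ)Φ = q(Θ-1)Θ`; discrete Leibniz rule), and
* `B_{f(·+1)}(n,·) = β A_f(n,·) + A_f(n+1,·)`  (`βf(Θ) + S f(Θ) = f(Θ+1)Φ`; Pascal's rule),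
proved here for arbitrary real functions; combined with `DiffHurwitz.chain_tn` they give
`DiffHurwitz.routh_tn`: if the functional Routh recursion `p_k = p_{k+1} + c_k·x·q_k(x-1)`,
`q_k = q_{k+1} + c'_k·p_{k+1}(x+1)` runs with nonnegative constants from `(p_0,q_0)` down to
`(κ, 0)`, `κ ≥ 0`, then the difference–Hurwitz matrix `interleave(p_0(Θ), q_0(Θ)Φ)` is totally nonnegative.
-/

namespace Summit.CriticalPhenomena.PercolationContinuityZ3.Theorems

namespace DiffHurwitz

open Finset Matrix fwdDiff

/-- Discrete Leibniz rule for `x ↦ x·u(x)`: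
`Δ^{d+1}(x u)(y) = y Δ^{d+1}u(y) + (d+1) Δ^{d} u(y+1)`. -/
theorem fwdDiff_iter_mulX (u : ℝ → ℝ) (d : ℕ) (y : ℝ) :
    (Δ_[(1 : ℝ)])^[d + 1] (fun x => x * u x) y =
      y * (Δ_[(1 : ℝ)])^[d + 1] u y + (d + 1 : ℝ) * (Δ_[(1 : ℝ)])^[d] u (y + 1) := by
  induction d generalizing y with
  | zero =>
    simp only [Function.iterate_one, Function.iterate_zero, id_eq, fwdDiff, CharP.cast_eq_zero,
      zero_add, one_mul]
    ring
  | succ d ih =>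
    rw [Function.iterate_succ_apply', fwdDiff, ih, ih,
      show (Δ_[(1 : ℝ)])^[d + 1 + 1] u y = ((Δ_[(1 : ℝ)])^[d + 1] u) (y + 1) - ((Δ_[(1 : ℝ)])^[d + 1] u) y
        from by rw [Function.iterate_succ_apply']; rfl,
      show (Δ_[(1 : ℝ)])^[d + 1] u (y + 1) = ((Δ_[(1 : ℝ)])^[d] u) (y + 1 + 1) - ((Δ_[(1 : ℝ)])^[d] u) (y + 1)
        from by rw [Function.iterate_succ_apply']; rfl]
    push_cast
    ring

/-- Iterated differences of a backward shift: `Δ^d (x ↦ q(x-1))(y) = (Δ^d q)(y-1)`. -/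
theorem fwdDiff_iter_shift_sub (q : ℝ → ℝ) (d : ℕ) (y : ℝ) :
    (Δ_[(1 : ℝ)])^[d] (fun x => q (x - 1)) y = (Δ_[(1 : ℝ)])^[d] q (y - 1) := by
  have h := fwdDiff_iter_comp_add (1 : ℝ) q (-1) d y
  simp only [← sub_eq_add_neg] at h
  exact h

/-- **Step A identity** (`D·q(Θ)Φ = q(Θ-1)Θ`).  With `A_f(n,l) = [l ≤ n] C(n,l) β^{n-l} (Δ^{n-l}f)(l)` and
`B_f(n,l) = β A_f(n,l) + [1 ≤ l] A_f(n,l-1)`:  `A_{x ↦ x q(x-1)}(n+1,l) = (n+1) B_q(n,l)`. -/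
theorem rowA_mulX (β : ℝ) (A : (ℝ → ℝ) → ℕ → ℕ → ℝ)
    (hA : ∀ f n l, A f n l =
      if l ≤ n then (n.choose l : ℝ) * β ^ (n - l) * (Δ_[(1 : ℝ)])^[n - l] f l else 0)
    (q : ℝ → ℝ) (n l : ℕ) :
    A (fun x => x * q (x - 1)) (n + 1) l =
      (n + 1 : ℝ) * (β * A q n l + if 1 ≤ l then A q n (l - 1) else 0) := by
  rw [hA, hA, hA]
  rcases Nat.lt_trichotomy l (n + 1) with hl | hl | hl
  · -- l ≤ n: d + 1 differences, d = n - l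
    have hln : l ≤ n := by omega
    obtain ⟨d, hd⟩ : ∃ d, n - l = d := ⟨n - l, rfl⟩
    rw [if_pos hl.le, if_pos hln, show n + 1 - l = d + 1 by omega, hd, fwdDiff_iter_mulX,
      fwdDiff_iter_shift_sub, fwdDiff_iter_shift_sub, show (l : ℝ) + 1 - 1 = l by ring]
    have hc1 : ((n + 1).choose l : ℝ) * (d + 1) = (n + 1 : ℝ) * (n.choose l) := by
      have h := Nat.choose_mul_succ_eq n l
      rw [show n + 1 - l = d + 1 by omega] at h
      have h' : (n.choose l : ℝ) * ((n : ℝ) + 1) = ((n + 1).choose l : ℝ) * ((d : ℝ) + 1) := by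
        exact_mod_cast h
      linear_combination -h'
    rcases Nat.eq_zero_or_pos l with hl0 | hl0
    · subst hl0
      rw [if_neg (by omega)]
      simp only [CharP.cast_eq_zero, zero_mul, zero_add, add_zero]
      have e : ((n + 1).choose 0 : ℝ) * β ^ (d + 1) * ((d + 1 : ℝ) * (Δ_[(1 : ℝ)])^[d] q 0)
          = (((n + 1).choose 0 : ℝ) * (d + 1)) * (β ^ (d + 1) * (Δ_[(1 : ℝ)])^[d] q 0) := by ring
      rw [e, hc1]; ring
    · rw [if_pos (show 1 ≤ l from hl0), if_pos (show l - 1 ≤ n by omega),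
        show n - (l - 1) = d + 1 by omega,
        show (((l - 1 : ℕ) : ℝ)) = (l : ℝ) - 1 by rw [Nat.cast_sub (by omega), Nat.cast_one]]
      have hc2 : ((n + 1).choose l : ℝ) * l = (n + 1 : ℝ) * (n.choose (l - 1)) := by
        obtain ⟨l', rfl⟩ : ∃ l', l = l' + 1 := ⟨l - 1, by omega⟩
        have h := Nat.add_one_mul_choose_eq n l'
        rw [Nat.add_sub_cancel]
        have h' : ((n + 1 : ℕ) : ℝ) * (n.choose l') = ((n + 1).choose (l' + 1)) * ((l' + 1 : ℕ) : ℝ) := by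
          exact_mod_cast h
        push_cast at h' ⊢
        linarith
      have e : ((n + 1).choose l : ℝ) * β ^ (d + 1) *
          ((l : ℝ) * (Δ_[(1 : ℝ)])^[d + 1] q ((l : ℝ) - 1) + (d + 1 : ℝ) * (Δ_[(1 : ℝ)])^[d] q l)
          = (((n + 1).choose l : ℝ) * l) * (β ^ (d + 1) * (Δ_[(1 : ℝ)])^[d + 1] q ((l : ℝ) - 1))
            + (((n + 1).choose l : ℝ) * (d + 1)) * (β ^ (d + 1) * (Δ_[(1 : ℝ)])^[d] q l) := by ring
      rw [e, hc1, hc2]; ring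
  · -- l = n + 1: no differences
    subst hl
    rw [if_pos le_rfl, if_neg (show ¬ n + 1 ≤ n by omega), if_pos (show 1 ≤ n + 1 by omega),
      Nat.add_sub_cancel, if_pos le_rfl, Nat.sub_self, Nat.sub_self]
    simp only [Function.iterate_zero, id_eq, Nat.choose_self, Nat.cast_one, pow_zero, one_mul,
      mul_zero, zero_add]
    push_cast; ring
  · have h1 : ¬ l ≤ n := by omega
    have h2 : ¬ l ≤ n + 1 := by omega
    have h3 : ¬ l - 1 ≤ n := by omega
    simp [h1, h2, h3]

/-- **Step B identity** (`βf(Θ) + S·f(Θ) = f(Θ+1)Φ`).  With `A`, `B` as above: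
`B_{f(·+1)}(n,l) = β A_f(n,l) + A_f(n+1,l)`. -/
theorem rowB_shift (β : ℝ) (A : (ℝ → ℝ) → ℕ → ℕ → ℝ)
    (hA : ∀ f n l, A f n l =
      if l ≤ n then (n.choose l : ℝ) * β ^ (n - l) * (Δ_[(1 : ℝ)])^[n - l] f l else 0)
    (f : ℝ → ℝ) (n l : ℕ) :
    β * A (fun x => f (x + 1)) n l + (if 1 ≤ l then A (fun x => f (x + 1)) n (l - 1) else 0) =
      β * A f n l + A f (n + 1) l := by
  have hsh : ∀ k (y : ℝ), (Δ_[(1 : ℝ)])^[k] (fun x => f (x + 1)) y = (Δ_[(1 : ℝ)])^[k] f (y + 1) :=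
    fun k y => fwdDiff_iter_comp_add 1 f 1 k y
  have hsucc : ∀ k (y : ℝ), (Δ_[(1 : ℝ)])^[k] f (y + 1) =
      (Δ_[(1 : ℝ)])^[k] f y + (Δ_[(1 : ℝ)])^[k + 1] f y := by
    intro k y
    rw [Function.iterate_succ_apply']
    simp [fwdDiff]
  rw [hA, hA, hA, hA]
  rcases Nat.lt_trichotomy l (n + 1) with hl | hl | hl
  · have hln : l ≤ n := by omega
    rw [if_pos hln, if_pos hln, if_pos hl.le, hsh, hsucc, show n + 1 - l = n - l + 1 by omega]
    rcases Nat.eq_zero_or_pos l with hl0 | hl0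
    · subst hl0
      rw [if_neg (by omega)]
      simp only [Nat.choose_zero_right, Nat.cast_one, one_mul, Nat.sub_zero, add_zero]
      ring
    · rw [if_pos (show 1 ≤ l from hl0), if_pos (show l - 1 ≤ n by omega),
        show n - (l - 1) = n - l + 1 by omega, hsh,
        show (((l - 1 : ℕ) : ℝ)) + 1 = (l : ℝ) by rw [Nat.cast_sub (by omega), Nat.cast_one]; ring]
      have hP : ((n + 1).choose l : ℝ) = n.choose l + n.choose (l - 1) := by
        obtain ⟨l', rfl⟩ : ∃ l', l = l' + 1 := ⟨l - 1, by omega⟩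
        rw [Nat.add_sub_cancel, Nat.choose_succ_succ, add_comm]
        push_cast; ring
      rw [hP]; ring
  · subst hl
    rw [if_neg (show ¬ n + 1 ≤ n by omega), if_pos (show 1 ≤ n + 1 by omega), Nat.add_sub_cancel,
      if_pos le_rfl, if_neg (show ¬ n + 1 ≤ n by omega), if_pos le_rfl, Nat.sub_self, Nat.sub_self, hsh]
    simp only [Function.iterate_zero, id_eq, mul_zero, zero_add, Nat.choose_self, Nat.cast_one,
      pow_zero, one_mul]
    push_cast; ring_nf
  · have h1 : ¬ l ≤ n := by omega
    have h2 : ¬ l ≤ n + 1 := by omega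
    have h3 : ¬ l - 1 ≤ n := by omega
    simp [h1, h2, h3]

/-- Iterated differences kill constants: `Δ^{d+1} (x ↦ κ) = 0`. -/
theorem fwdDiff_iter_const_succ (κ : ℝ) (d : ℕ) (y : ℝ) :
    (Δ_[(1 : ℝ)])^[d + 1] (fun _ => κ) y = 0 := by
  induction d generalizing y with
  | zero => simp [fwdDiff]
  | succ d ih => rw [Function.iterate_succ_apply', fwdDiff, ih, ih, sub_zero]

/-- Linearity of the rows `A_f` in `f`. -/
theorem rowA_lin (β : ℝ) (A : (ℝ → ℝ) → ℕ → ℕ → ℝ)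
    (hA : ∀ f n l, A f n l =
      if l ≤ n then (n.choose l : ℝ) * β ^ (n - l) * (Δ_[(1 : ℝ)])^[n - l] f l else 0)
    (f g : ℝ → ℝ) (a : ℝ) (n l : ℕ) :
    A (fun x => f x + a * g x) n l = A f n l + a * A g n l := by
  rw [hA, hA, hA]
  split_ifs
  · have hfg : (fun x => f x + a * g x) = f + a • g := by
      funext x; simp [smul_eq_mul]
    rw [hfg, fwdDiff_iter_add, fwdDiff_iter_const_smul]
    simp only [Pi.add_apply, Pi.smul_apply, smul_eq_mul]
    ring
  · ring

/-- Rows of a constant: `A_κ(n,l) = [l = n] κ`, i.e. `κ(Θ) = κ·1`. -/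
theorem rowA_const (β : ℝ) (A : (ℝ → ℝ) → ℕ → ℕ → ℝ)
    (hA : ∀ f n l, A f n l =
      if l ≤ n then (n.choose l : ℝ) * β ^ (n - l) * (Δ_[(1 : ℝ)])^[n - l] f l else 0)
    (κ : ℝ) (n l : ℕ) : A (fun _ => κ) n l = if l = n then κ else 0 := by
  rw [hA]
  rcases Nat.lt_trichotomy l n with hl | hl | hl
  · rw [if_pos hl.le, if_neg hl.ne, show n - l = (n - l - 1) + 1 by omega, fwdDiff_iter_const_succ,
      mul_zero]
  · subst hl; simp
  · rw [if_neg (by omega), if_neg (by omega)]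

/-- **THEOREM (discrete Routh algorithm ⇒ TN).**  Let `β ≥ 0` and let `A_f(n,l) = [l ≤ n] C(n,l) β^{n-l}
(Δ^{n-l} f)(l)` be the rows of `f(Θ)`, `Θ = βD + N̂`, so that `β A_f(n,l) + A_f(n,l-1)` are the rows of
`f(Θ)Φ`, `Φ = βI + S`.  If real functions `p_k, q_k` (`k = 0..T`) and constants `c_k, c'_k ≥ 0` satisfy
the Routh recursion `p_k(x) = p_{k+1}(x) + c_k·x·q_k(x-1)`, `q_k(x) = q_{k+1}(x) + c'_k·p_{k+1}(x+1)`
(`k < T`) with `p_T ≡ κ ≥ 0` and `q_T ≡ 0`, then the difference–Hurwitz matrix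
`interleave(p_0(Θ), q_0(Θ)Φ)` (rows `2n ↦ p_0(Θ)_n`, `2n+1 ↦ (q_0(Θ)Φ)_n`) is totally nonnegative.
For a polynomial `P` with positive leading coefficient, only real zeros, all `≤ 0`, and mesh `> 1`, the
recursion started at `(P, ΔP)` runs with positive constants (memo §2.3), so `interleave(P(Θ), ΔP(Θ)Φ)` is TN. -/
theorem routh_tn (β : ℝ) (hβ : 0 ≤ β) (A : (ℝ → ℝ) → ℕ → ℕ → ℝ)
    (hA : ∀ f n l, A f n l =
      if l ≤ n then (n.choose l : ℝ) * β ^ (n - l) * (Δ_[(1 : ℝ)])^[n - l] f l else 0)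
    (T : ℕ) (p q : ℕ → ℝ → ℝ) (c c' : ℕ → ℝ) (κ : ℝ) (hκ : 0 ≤ κ)
    (hc : ∀ k, 0 ≤ c k) (hc' : ∀ k, 0 ≤ c' k)
    (hp : ∀ k, k < T → ∀ x, p k x = p (k + 1) x + c k * (x * q k (x - 1)))
    (hq : ∀ k, k < T → ∀ x, q k x = q (k + 1) x + c' k * p (k + 1) (x + 1))
    (hpT : ∀ x, p T x = κ) (hqT : ∀ x, q T x = 0)
    {m : ℕ} (r s : Fin m → ℕ) (hr : StrictMono r) (hs : StrictMono s) :
    0 ≤ (Matrix.of fun i j =>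
      if r i % 2 = 0 then A (p 0) (r i / 2) (s j)
      else β * A (q 0) (r i / 2) (s j) + if 1 ≤ s j then A (q 0) (r i / 2) (s j - 1) else 0).det := by
  have key := chain_tn T (fun k n l => A (p k) n l)
    (fun k n l => β * A (q k) n l + if 1 ≤ l then A (q k) n (l - 1) else 0)
    c (fun k => β * c' k) c' κ hκ hc (fun k => mul_nonneg hβ (hc' k)) hc' ?_ ?_ ?_ ?_ ?_ r s hr hs
  · exact key
  · -- X_k 0 = X_{k+1} 0
    intro k hk l
    have hpk : p k = fun x => p (k + 1) x + c k * (x * q k (x - 1)) := funext (hp k hk)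
    rw [hpk, rowA_lin β A hA, hA (fun x => x * q k (x - 1))]
    split_ifs with h
    · have hl : l = 0 := by omega
      subst hl; simp
    · ring
  · -- step A
    intro k hk n l
    have hpk : p k = fun x => p (k + 1) x + c k * (x * q k (x - 1)) := funext (hp k hk)
    rw [hpk, rowA_lin β A hA, rowA_mulX β A hA]
    ring
  · -- step B
    intro k hk n l
    have hqk : q k = fun x => q (k + 1) x + c' k * p (k + 1) (x + 1) := funext (hq k hk)
    rw [hqk, rowA_lin β A hA, rowA_lin β A hA]
    have hB := rowB_shift β A hA (p (k + 1)) n l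
    split_ifs with h
    · rw [if_pos h] at hB
      linear_combination (c' k) * hB
    · rw [if_neg h] at hB
      linear_combination (c' k) * hB
  · -- terminal X
    intro n l
    have hpT' : p T = fun _ => κ := funext hpT
    rw [hpT', rowA_const β A hA]
  · -- terminal Y
    intro n l
    have hqT' : q T = fun _ => (0 : ℝ) := funext hqT
    rw [hqT', rowA_const β A hA, rowA_const β A hA]
    split_ifs <;> simp

end DiffHurwitz

end Summit.CriticalPhenomena.PercolationContinuityZ3.Theorems
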